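import Summits.ResolutionOfSingularities.ResolutionOfSingularities.Theses.FoliationDescent
import Summits.ResolutionOfSingularities.ResolutionOfSingularities.Theorems.FolLU.Negative.SameModel
import HarnessLib

/-!
# Disproof of `FolLU` (stmt-ResolutionOfSingularities-17081) — standing disprover's work file

Crux `FoliationDescent.FolLU` (FOLIATION LOCAL UNIFORMIZATION): over a perfect field `k` of characteristic
`p`, along a valuation ring `O` of `K/k`, a f.g. model `S ≤ O` of `K` regular at the centre and a non-zero
`p`-closed `k`-derivation `D` of `K` admit a f.g. model `S ≤ S' ≤ O`, regular at the centre, and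
`g ≠ 0` with `g • D ↷ S'_c` NON-SINGULAR (a value is a unit) or MULTIPLICATIVE (`(g•D)^p = u (g•D)`,
`u` a unit of `S'_c`).

## Findings (cycle 1, 2026-08-17, refuter-cdisprove-…-17081-0) — NO KILL

* **Verdict so far.** `FolLU` is a faithful typing of an OPEN problem (valuative log-canonical =
  log-elementary reduction of a rank-one `p`-closed vector field keeping the ambient REGULAR). It
  elaborates (rc 0), has no junk operators, is non-vacuous, and every degenerate instance is TRUE
  (trivial valuation, `D = 0`, trdeg ≤ 1, divisorial `O`, `p = 2 ∧ trdeg ≤ 3` by Posva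
  arXiv:2405.05735 Thm 5.3.1, trdeg 2 over `k = k̄` by RS76 / Posva Thm 4.0.1) — see also the
  r1 attack `Cruxes/FolLU/CruxAttackR1.md` whose read-back we confirm.
* **Load-bearing hypotheses** (§1). `D ≠ 0` is decoration (r1, Lean). `S.FG`, `IsFractionRing S K`
  are load-bearing for bookkeeping reasons only. The ONE sharp hypothesis is `p`-closedness: without it
  the statement is false (`folLU_false_without_pClosed`, PAPER proof recorded below — the Lean proof
  needs Abhyankar's factorization of 2-dimensional regular local rings along a valuation, absent from
  the tree; stated here with `sorry` as a near-miss). `PerfectField k` untested (no cheap witness;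
  imperfect `k` is delegated to `DescentPerfectToAll` by the route). Dropping regularity of `S` turns the
  statement into plain local uniformization (open, not cheaply refutable).
* **Tightness of the conclusion** (§2). (a) The model MUST change: `FolLUSameModel` (`S' := S`) is
  false — witness the saturated ADDITIVE point of order two `D = x²∂_x + y²∂_y` (`D^p = 0`) at the
  origin of `𝔸²` (this is exactly the non-vacuity of `stub_orderReduction`'s input regime in
  `Lines/birth.lean`); LANDED in Lean: `Theorems/FolLU/Negative/SameModelSetup.lean` (p153245) +
  `Theorems/FolLU/Negative/SameModel.lean` (p153809, `folLU_false_sameModel`, witness `p = 2`,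
  `k = 𝔽₂`, `K = Frac 𝔽₂[x,y]`, `O = ord_(x,y)`), imported here as `not_folLUSameModel`.
  (b) The MULTIPLICATIVE exit cannot be deleted for `p ≥ 5`
  (`FolLUNonsingularOnly` false, PAPER modulo Abhyankar; its certified combinatorial core is the
  Euclid dynamics of eigenvalue ratios under point blow-ups: a walk on `𝔽_p ∖ {0}` with moves
  `r ↦ r − 1`, `r ↦ r/(1−r)` from `r ≠ 1`; `ratioWalk_cycle_five/seven` exhibit cycles (decide), while
  `ratioWalk_dies_two/three` show absorption for `p = 2, 3` — consistent with Hirokado/Posva `p = 2`).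
* **Where a counterexample can live** (§3, the route's own "cheapest falsifier", run this cycle as
  code `compute/blowup/`, evidence `blowup_code.py.txt`): valuations `O ⊇ k(x)` of `K = k(x,y,z)`. Then every
  admissible local ring `S'_c` is a 2-dimensional regular local ring containing `k(x)` and dominated by
  `O`, hence (Abhyankar 1956, Thm 3) an iterated quadratic transform of `S_c` along `O`; so an ADDITIVE
  singular point RECURRING under all quadratic transforms along one such `O` refutes `FolLU` on paper.
  New phenomena vs. the classical surface case: residue fields `κ ⊇ k(x)` are IMPERFECT, `D` need not be
  `κ`-linear (`D x ≠ 0`), and centres may be INSEPARABLE points of the exceptional line. We prove (paper,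
  §3 docstring) that also in this relative setting a saturated `p`-closed singular point is
  multiplicative iff its linear part on `𝔪/𝔪²` is non-nilpotent, so the game is decidable jet-wise; the
  job follows all additive centres that are rational over `k(x)`, graphs `t(z)x = s(z)`, or inseparable
  points `z^p = αx + β`, for `D = J(f,g,·)` (all `p`-closed `D` are rescalings of Jacobian derivations,
  Jacobson) with random low-degree `f, g` over `𝔽_p`, `p ∈ {2,3,5,7}`. RESULT: 4200 / 4200 additive chains terminate
  (max depth 9, none periodic) — no evidence against `FolLU` (§3, evidence `EXPERIMENT-relsurf.json`).
* **Stubs of line `birth`.** `stub_orderReduction` and `stub_nilpotentExit` are each IMPLIED by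
  `FolLU` + saturation (birth.md's argument checked: a multiplicative non-saturated `δ = f δ''` has
  `(δ'' f)^{p-1} ≡ c' (mod f)`, so `δ''` is non-singular), hence admit no cheaper kill than the crux;
  `stub_saturation` is provable (positive; not ours). No stuck stubs were handed to this seat.

## How to read this file
Prose lives in docstrings. `sorry` marks NEAR-MISSES only (paper proofs whose formalization needs
infrastructure named in the docstring); everything else is kernel-checked. Sections: §0 named clauses ·
§1 load-bearing analysis · §2 tightness / refuted strengthenings · §3 the relative-surface test-bed ·
§4 targets (none yet).
-/

set_option linter.dupNamespace false
set_option linter.unusedVariables false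

noncomputable section

open Summit.ResolutionOfSingularities.ResolutionOfSingularities.Theses.FoliationDescent

namespace Summit.ResolutionOfSingularities.ResolutionOfSingularities.Cruxes.FolLU.Disproof

/-! ## §0 The route file's clauses, named (verbatim bodies) -/

section Clauses

variable {k K : Type} [Field k] [Field K] [Algebra k K]

/-- `x ∈ S_c` (local ring of the model `S` at the centre of `O`) — verbatim the route clause. [folklore] -/
def InCtr (O : ValuationSubring K) (S : Subalgebra k K) (x : K) : Prop :=
  ∃ a b : K, a ∈ S ∧ b ∈ S ∧ b ≠ 0 ∧ b⁻¹ ∈ O ∧ x = a / b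

/-- `S` regular at the centre of `O` — verbatim the route clause. [folklore] -/
def RegularAtCtr (O : ValuationSubring K) (S : Subalgebra k K) (hS : S.toSubring ≤ O.toSubring) : Prop :=
  IsRegularLocalRing (Localization.AtPrime (Ideal.comap (Subring.inclusion hS) (IsLocalRing.maximalIdeal O)))

/-- `δ` maps `S_c` into itself — verbatim. [folklore] -/
def Preserves (O : ValuationSubring K) (S : Subalgebra k K) (δ : Derivation k K K) : Prop :=
  ∀ x : K, InCtr O S x → InCtr O S (δ x)

/-- NON-SINGULAR at the centre: some value on `S_c` is a unit — verbatim. [folklore] -/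
def NonSingular (O : ValuationSubring K) (S : Subalgebra k K) (δ : Derivation k K K) : Prop :=
  ∃ x : K, InCtr O S x ∧ δ x ≠ 0 ∧ (δ x)⁻¹ ∈ O

/-- MULTIPLICATIVE at the centre: `δ^p = u δ` on `K` with `u` a unit of `S_c` — verbatim. [folklore] -/
def Multiplicative (p : ℕ) (O : ValuationSubring K) (S : Subalgebra k K) (δ : Derivation k K K) : Prop :=
  ∃ u : K, InCtr O S u ∧ u ≠ 0 ∧ u⁻¹ ∈ O ∧ ∀ x : K, (⇑δ)^[p] x = u * δ x

/-- `p`-closedness of `D` — verbatim. [folklore] -/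
def PClosed (p : ℕ) (D : Derivation k K K) : Prop :=
  ∃ c : K, ∀ x : K, (⇑D)^[p] x = c * D x

/-- The conclusion of `FolLU` at `(p, O, S, D)` — verbatim modulo the names above. [folklore] -/
def Conclusion (p : ℕ) (O : ValuationSubring K) (S : Subalgebra k K) (D : Derivation k K K) : Prop :=
  ∃ (S' : Subalgebra k K) (h' : S'.toSubring ≤ O.toSubring) (g : K), S ≤ S' ∧ S'.FG ∧
    IsFractionRing S' K ∧ RegularAtCtr O S' h' ∧ g ≠ 0 ∧ Preserves O S' (g • D) ∧
    (NonSingular O S' (g • D) ∨ Multiplicative p O S' (g • D))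

/-- Log-canonicity ON THE GIVEN MODEL (no `S'`): the conclusion of the strengthening `FolLUSameModel`.
[folklore] -/
def ConclusionAt (p : ℕ) (O : ValuationSubring K) (S : Subalgebra k K) (D : Derivation k K K) : Prop :=
  ∃ g : K, g ≠ 0 ∧ Preserves O S (g • D) ∧ (NonSingular O S (g • D) ∨ Multiplicative p O S (g • D))

end Clauses

/-- Unfolding check: `FolLU` is literally `∀ …, hyps → Conclusion p O S D`. [folklore] -/
theorem folLU_iff : FolLU ↔ ∀ p : ℕ, p.Prime → ∀ (k K : Type) [Field k] [CharP k p] [PerfectField k]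
    [Field K] [Algebra k K] (O : ValuationSubring K) (S : Subalgebra k K) (hS : S.toSubring ≤ O.toSubring)
    (D : Derivation k K K), S.FG → IsFractionRing S K → RegularAtCtr O S hS → D ≠ 0 → PClosed p D →
    Conclusion p O S D :=
  Iff.rfl

/-! ## §1 Load-bearing analysis: the crux with one hypothesis dropped -/

/-- `FolLU` with `p`-CLOSEDNESS dropped. [folklore] -/
def FolLUWithoutPClosed : Prop :=
  ∀ p : ℕ, p.Prime → ∀ (k K : Type) [Field k] [CharP k p] [PerfectField k] [Field K] [Algebra k K]
    (O : ValuationSubring K) (S : Subalgebra k K) (hS : S.toSubring ≤ O.toSubring) (D : Derivation k K K),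
    S.FG → IsFractionRing S K → RegularAtCtr O S hS → D ≠ 0 → Conclusion p O S D

/-- The dropped-hypothesis variant is at least as strong (sanity). [folklore] -/
theorem folLU_of_withoutPClosed (h : FolLUWithoutPClosed) : FolLU :=
  fun p hp k K _ _ _ _ _ O S hS D hfg hfr hreg hD _ => h p hp k K O S hS D hfg hfr hreg hD

/-- **NEAR-MISS (paper proof; `sorry` = Abhyankar's factorization not in tree).** `p`-closedness is
LOAD-BEARING: `FolLUWithoutPClosed` is false.

Witness: any `p`, `k = 𝔽_{p²}` (perfect), `K = k(x,y)`, `S = k[x,y]`, `D = x∂_x + λ y∂_y` with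
`λ ∈ k ∖ 𝔽_p`, and `O` the rank-two valuation ring `x ≫ y` (value group `ℤ ×ₗ ℤ`, `v x = (1,0)`,
`v y = (0,1)`), centred at the origin on `S`.
1. `D^p = x∂_x + λ^p y∂_y ∉ K·D` (`λ^p ≠ λ`), and MULTIPLICATIVE ⇒ `p`-closed (Hochschild:
   `(gD)^p = g^p D^p + (gD)^{p-1}(g)·D`, so `(gD)^p = u g D` puts `D^p ∈ K·D`): the multiplicative exit
   is unavailable for every `g` on every model.
2. Every admissible `S'_c` is a two-dimensional regular local ring birationally dominating
   `S_c = k[x,y]_{(x,y)}` and dominated by `O` (residue field of `O` is `k`, so centres are closed points),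
   hence an iterated quadratic transform of `S_c` ALONG `O` (Abhyankar, Amer. J. Math. 78 (1956), Thm 3);
   along this `O` these are `R_n = k[x/yⁿ, y]_{(x/yⁿ, y)}`, `n ≥ 0`.
3. On `R_n`, with `w = x/yⁿ`: `D = (1 − nλ) w∂_w + λ y∂_y`, both coefficients non-zero (`λ ∉ 𝔽_p`),
   values generate `𝔪 = (w, y)`: saturated and SINGULAR, so no rescaling `g•D ↷ R_n` has a unit value
   (`g•D (R_n) ⊆ R_n` forces `g ∈ R_n` as `w, y` are coprime, then all values lie in `𝔪`).
Hence `Conclusion p O S D` fails. (Lean: items 1 and 3 are formalizable today; item 2 is the gap.)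
[cite: doi:10.2307/2372519 (Abhyankar 1956), Thm 3; doi:10.1070/im1976v010n06abeh001833, §1] -/
theorem folLU_false_without_pClosed : ¬ FolLUWithoutPClosed := by
  sorry

/-- `FolLU` with finite generation of the GIVEN model dropped. [folklore] -/
def FolLUWithoutFG : Prop :=
  ∀ p : ℕ, p.Prime → ∀ (k K : Type) [Field k] [CharP k p] [PerfectField k] [Field K] [Algebra k K]
    (O : ValuationSubring K) (S : Subalgebra k K) (hS : S.toSubring ≤ O.toSubring) (D : Derivation k K K),
    IsFractionRing S K → RegularAtCtr O S hS → D ≠ 0 → PClosed p D → Conclusion p O S D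

/-- Sanity: the variant implies the crux. [folklore] -/
theorem folLU_of_withoutFG (h : FolLUWithoutFG) : FolLU :=
  fun p hp k K _ _ _ _ _ O S hS D _ hfr hreg hD hpc => h p hp k K O S hS D hfr hreg hD hpc

/-- **NEAR-MISS (paper; bookkeeping only).** `S.FG` is load-bearing for a trivial reason: with
`S := O` a DVR of `k(x)` (e.g. `k[x]_{(x)}`, `D = d/dx`, `D^p = 0`), the conclusion asks for a
finitely generated `k`-subalgebra `S'` with `O ≤ S' ≤ O`, but `k[x]_{(x)}` is not finitely generated
over `k` (a local domain finitely generated over a field is Jacobson, hence a field). Formalizable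
(Mathlib: Jacobson rings, `RatFunc`, `Polynomial.derivative`); low information value, not pursued. The
same witness with `S := ⊥`, `K = k(x₁, x₂, …)` shows `IsFractionRing S K` is load-bearing (no f.g.
`S'` has `Frac S' = K`). [folklore] -/
theorem folLU_false_without_fg : ¬ FolLUWithoutFG := by
  sorry

/-! ## §2 Tightness: refuted strengthenings of the conclusion -/

/-- STRENGTHENING 1 — no change of model: log-canonicity of a rescaling of `D` on the GIVEN regular
model `S`. [folklore] -/
def FolLUSameModel : Prop :=
  ∀ p : ℕ, p.Prime → ∀ (k K : Type) [Field k] [CharP k p] [PerfectField k] [Field K] [Algebra k K]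
    (O : ValuationSubring K) (S : Subalgebra k K) (hS : S.toSubring ≤ O.toSubring) (D : Derivation k K K),
    S.FG → IsFractionRing S K → RegularAtCtr O S hS → D ≠ 0 → PClosed p D → ConclusionAt p O S D

/-- Sanity: the same-model strengthening implies the crux (`S' := S`). [folklore] -/
theorem folLU_of_sameModel (h : FolLUSameModel) : FolLU := by
  intro p hp k K _ _ _ _ _ O S hS D hfg hfr hreg hD hpc
  obtain ⟨g, hg, hpres, hterm⟩ := h p hp k K O S hS D hfg hfr hreg hD hpc
  exact ⟨S, hS, g, le_rfl, hfg, hfr, hreg, hg, hpres, hterm⟩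

/-- **ADDITIVE POINTS EXIST: the model must change** (`FolLUSameModel` is false). Witness: `p = 2`,
`k = 𝔽₂`, `K = Frac 𝔽₂[x,y]`, `S = 𝔽₂[x,y]`, `O` = the order valuation `ord_{(x,y)}` (divisorial;
centre = the origin), `D = x²∂_x + y²∂_y` (`D² = 0`: in the generators `X = 1/x, Y = 1/y` of `K`,
`D = ∂_X + ∂_Y`). For `g ≠ 0` with `g•D ↷ S_c`: `g x², g y² ∈ S_c` and `x ∤ y` force `g ∈ S_c`
(`𝔽₂[x,y]` is a UFD, `X_prime`), so every value `g•D f = g (f_x x² + f_y y²)` has order ≥ 2: not a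
unit (NON-SINGULAR fails); and `ord (D h) ≥ ord h + 1` on `K` gives
`ord ((g•D)^[2] x) ≥ 2·ord g + 3 > ord g + 2 = ord (u · g•D x)` for a unit `u`, so MULTIPLICATIVE fails.
This is the certified non-vacuity of the ADDITIVE regime (input of `stub_orderReduction` /
`stub_nilpotentExit` in `Lines/birth.lean`). LANDED (kernel-checked, definition-free, axioms
propext · Classical.choice · Quot.sound): `Theorems/FolLU/Negative/SameModelSetup.lean` (p153245,
order valuation, the derivation, `D ∘ D = 0`, growth) and `Theorems/FolLU/Negative/SameModel.lean`
(p153809, `folLU_false_sameModel`); the statement below is that theorem re-read through this file's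
named clauses (definitional unfolding only). [folklore] -/
theorem not_folLUSameModel : ¬ FolLUSameModel :=
  Summit.ResolutionOfSingularities.ResolutionOfSingularities.Theorems.folLU_false_sameModel

/-- STRENGTHENING 2 — no multiplicative exit: a NON-SINGULAR rescaling is reached along every
valuation. [folklore] -/
def FolLUNonsingularOnly : Prop :=
  ∀ p : ℕ, p.Prime → ∀ (k K : Type) [Field k] [CharP k p] [PerfectField k] [Field K] [Algebra k K]
    (O : ValuationSubring K) (S : Subalgebra k K) (hS : S.toSubring ≤ O.toSubring) (D : Derivation k K K),
    S.FG → IsFractionRing S K → RegularAtCtr O S hS → D ≠ 0 → PClosed p D →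
    ∃ (S' : Subalgebra k K) (h' : S'.toSubring ≤ O.toSubring) (g : K), S ≤ S' ∧ S'.FG ∧
      IsFractionRing S' K ∧ RegularAtCtr O S' h' ∧ g ≠ 0 ∧ Preserves O S' (g • D) ∧ NonSingular O S' (g • D)

/-- Sanity: the non-singular-only strengthening implies the crux. [folklore] -/
theorem folLU_of_nonsingularOnly (h : FolLUNonsingularOnly) : FolLU := by
  intro p hp k K _ _ _ _ _ O S hS D hfg hfr hreg hD hpc
  obtain ⟨S', h', g, hle, hfg', hfr', hreg', hg, hpres, hns⟩ := h p hp k K O S hS D hfg hfr hreg hD hpc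
  exact ⟨S', h', g, hle, hfg', hfr', hreg', hg, hpres, Or.inl hns⟩

/-- **NEAR-MISS (paper modulo Abhyankar): the multiplicative exit is necessary for `p ≥ 5`.**
Witness: `p ≥ 5`, `k = 𝔽_p`, `K = k(x,y)`, `S = k[x,y]`, `D = x∂_x + 2y∂_y` (`D^p = D`), `O` a
zero-dimensional valuation realising the periodic chart choice below. Under a quadratic transform a
diagonal field `a x∂_x + b y∂_y` (`a, b ∈ 𝔽_p^×`) becomes `a x∂_x + (b−a) v∂_v` (chart `y = xv`) or
`(a−b) w∂_w + b y∂_y` (chart `x = yw`); it is resolved (non-singular after saturation) exactly when an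
eigenvalue becomes `0`. On ratios `r = b/a` the adversary walks on `𝔽_p ∖ {0}` by `r ↦ r − 1` or
`r ↦ r/(1−r)` (both legal iff `r ≠ 1`); an infinite legal walk = a valuation along which every model
carries a multiplicative SINGULAR point, and no other regular models exist along it (Abhyankar). For
`p ≥ 5` the walk `2 → −2 → −3 → ⋯ → 2` (one second-chart move, then `p − 4` first-chart moves) is
legal and periodic (`ratioWalk_cycle_five`, `ratioWalk_cycle_seven` certify `p = 5, 7`); for `p = 2, 3`
every walk dies in ≤ 2 steps (`ratioWalk_dies_two`, `ratioWalk_dies_three`), matching Hirokado /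
Posva (`p = 2`: regular ambient AND regular foliation, arXiv:2405.05735 Thm 5.3.1) and Posva's remark
that for `p > 2` the toric foliations are not resolvable with regular ambient (arXiv:2311.16694, p. 2;
the `p = 3` toric fields ARE absorbed locally along every valuation — the obstruction there is only
global). [cite: arXiv:2311.16694, §1 p. 2 and Example (sing_of_toric_derivation)] -/
theorem not_folLUNonsingularOnly : ¬ FolLUNonsingularOnly := by
  sorry

/-- One legal move of the eigenvalue-ratio walk (`r ≠ 1`; targets are automatically `≠ 0`):
first chart `s = r − 1`, second chart `s = r/(1−r)` written division-free. [folklore] -/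
abbrev RatioStep {p : ℕ} (r s : ZMod p) : Prop :=
  r ≠ 0 ∧ r ≠ 1 ∧ (s = r - 1 ∨ s * (1 - r) = r)

/-- **Certified core, `p = 5`: a legal 2-cycle `2 → 3 → 2`** (`3 = 2/(1−2)`, `2 = 3 − 1`), i.e. an
infinite legal walk: along the corresponding valuation the multiplicative point `x∂_x + 2y∂_y` is
never absorbed. [folklore] -/
theorem ratioWalk_cycle_five : RatioStep (2 : ZMod 5) 3 ∧ RatioStep (3 : ZMod 5) 2 := by decide

/-- **Certified core, `p = 7`: the legal 3-cycle `2 → 5 → 4 → 3 → 2`… precisely `2 → −2 = 5`, then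
`5 → 4 → 3 → 2`.** [folklore] -/
theorem ratioWalk_cycle_seven :
    RatioStep (2 : ZMod 7) 5 ∧ RatioStep (5 : ZMod 7) 4 ∧ RatioStep (4 : ZMod 7) 3 ∧
      RatioStep (3 : ZMod 7) 2 := by decide

/-- **Certified core, `p = 3`: every legal move lands on the dead end `r = 1`** (both charts), so
every walk dies within two steps: multiplicative points are absorbed for `p = 3`. [folklore] -/
theorem ratioWalk_dies_three : ∀ r s : ZMod 3, RatioStep r s → s = 1 := by decide

/-- **Certified core, `p = 2`: there is no legal move at all** (`𝔽₂ ∖ {0} = {1}`). [folklore] -/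
theorem ratioWalk_dies_two : ∀ r s : ZMod 2, ¬ RatioStep r s := by decide

/-! ## §3 The relative-surface test-bed (`O ⊇ k(x)`): why it has refutation power, and the run

PAPER LEMMA (recorded for ideators; used by the kit job's classifier). Let `R ⊇ k(x)` be a
two-dimensional regular local ring essentially of finite type over `k`, `𝔪 = (u,v)`, `δ` a `k`-derivation
of `Frac R` with `δ(R) ⊆ 𝔪` (singular), saturated, `δ^p = c δ` with `c ∈ R`. Then `δ` induces a
`κ`-LINEAR endomorphism `L` of `𝔪/𝔪²` (Leibniz: `δ(r n) = δ(r) n + r δ(n) ∈ 𝔪²` for `n ∈ 𝔪`) with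
`L^p = c̄ L`, and: `c` is a unit ⇔ `L` is not nilpotent. (⇐ clear. ⇒: if `L` were nilpotent then
`L = 0` (`L^p = c̄L`, `c̄ ≠ 0`, nilpotent ⇒ `L = 0`), so `δ(𝔪) ⊆ 𝔪²`, `δ(𝔪^j) ⊆ 𝔪^{j+1}` and
`δ` raises `𝔪`-adic order of every element by ≥ 1 (units included, as `δ(R) ⊆ 𝔪`… and then
`δ x ∈ 𝔪^p` from `δ^p x = c δ x`); comparing orders in `δ^p h = c δ h` for any `h` with `δ h ≠ 0`
gives `ord δh + (p−1) ≤ ord δh`, absurd.) NOTE the relative twist: `δ` may move the coefficient field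
(`δ x ≠ 0`), so "order one" must be read on `𝔪/𝔪²`, not on all values.

CONSEQUENCE. `FolLU` restricted to valuation rings `O ⊇ k(x)` of `K = k(x,u,v)` is a decidable
jet-level game: blow up the centre (a closed point of the `k(x)`-surface), saturate by the exceptional
parameter, list the singular closed points of the exceptional line `ℙ¹_κ`, keep the ADDITIVE ones
(linear part nilpotent), repeat; by Abhyankar's factorization an infinite chain of additive points IS a
counterexample to `FolLU` (and a finite tree for every `D` is what `FolLU` predicts). The search engine
(`compute/blowup/{polys,engine,main}.py` in the disprover's folder = item evidence `blowup_code.py.txt`,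
pure python, `p ∈ {2,3,5,7}`, random Jacobian derivations `J(f,g,·)` from six families incl.
inseparable-flavoured and high-order ones) follows all additive
centres rational over the current `k(x')`, all graphs `t(z)x = s(z)` and the inseparable points among
them (re-coordinatised by `x' := z`), and LOGS the centres it cannot re-coordinatise (non-rational
curves of the exceptional plane). RESULT (2026-08-17; the three job configurations were run in
the disprover's folder with the identical code — the queued kit jobs `j024700/j024920/j024932` were then
cancelled as redundant; digest `EXPERIMENT-relsurf.json` and source `blowup_code.py.txt` are item
evidence): **4200 saturated ADDITIVE Jacobian derivations** (`p = 2, 3, 5, 7`; seeds 1/2/3; N = 150 /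
400 / 500 per prime; depth caps 9 / 10 / 12; families: `f ∈ (y,z)² + k[x^p]` with `g` general so that
`D x ≠ 0`, both in `(y,z)² + k[x]`, inseparable-flavoured `f = z^p − x·(…)` / `y^p + xz`, high-order
`f ∈ (y,z)^{3..5} + k[x^p]`, and `(y,z)²`-ideals with `x`-dependent coefficients): **4200 / 4200 additive
chains terminate** (every leaf non-singular or multiplicative), depth histogram
`{0: 1682, 1: 1312, 2: 968, 3: 191, 4: 31, 5: 6, 6: 4, 7: 3, 8: 2, 9: 1}`, no chain alive at the cap, no
periodic state; 552 exceptional curves were not parametrisable by `x` or by `z` and were skipped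
(logged). Deepest example (`p = 2`): `D = (xz + z³ + xy²z + xy³) ∂_x + (yz + y³z + y⁴) ∂_y +
(z² + y²z² + y³z) ∂_z`, eight successive additive points alternating the centres `z₁ = 0` and
`z₁ = 1` on the exceptional lines before becoming log-canonical; (`p = 3`, depth 9):
`f = 1 + x³ + 2xz³ + 2x³y² + 2x⁶ + x³y⁴`, `g = 2 + x + x² + x³ + 2xyz³ + xy²z² + 2x²y³ + …`.
So far the relative setting (imperfect residue fields `⊇ k(x)`, `D x ≠ 0`, inseparable centres —
NOT covered by Posva, who works over `k = k̄`, arXiv:2405.05735 §2.1) behaves exactly like the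
classical surface case (RS76 / Posva Thm 4.0.1): NO EVIDENCE AGAINST `FolLU`. What would sharpen the
test next: constant-field extensions `𝔽_{p^d}` (to follow the skipped separable centres), the
non-rational exceptional curves (genus ≥ 1 residue fields), and — the real open case — closed-point
centres in dimension three, where point blow-ups are not cofinal among models and a persistent chain
would only inform the counter, not refute the crux.
-/

/-! ## §4 Targets (lead's stuck stubs): none handed to this seat yet (payload `stuck_stubs = []`). -/

end Summit.ResolutionOfSingularities.ResolutionOfSingularities.Cruxes.FolLU.Disproof

end
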